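import Summits.QuantumFields.YangMills.Theses.LangevinControlUV
import Summits.QuantumFields.YangMills.Theorems.FemtoCurvatureTwoPoint.Negative.UpperOnly

/-!
# `FemtoCurvatureTwoPointC` — tightness of the `Continuous a` repair: the crux minus its lower
# bound is still a theorem, and the `∀ a`-strengthening is false (parasitic continuous unit maps)

Negative-side lemmas for crux `Summit.QuantumFields.YangMills.Theses.LangevinControlUV.
FemtoCurvatureTwoPointC` (item stmt-QuantumFields-16204; cdisprove cycle 1, importable extract of
`§ UpperOnlyC` of the crux workfile
`Summits/QuantumFields/YangMills/Cruxes/FemtoCurvatureTwoPointC/Disproof.lean`).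

* `exists_continuous_majorant` (analysis) — every `σ : ℝ → ℝ` with `0 < σ ≤ 1` and `σ → 0` at
  `+∞` lies below a CONTINUOUS positive `g → 0` (`g(β) = ∫_β^{β+1} E`, `E` the running supremum of
  `σ`). It converts every step-unit-map construction of the typed item into one with a continuous
  unit map.
* `exists_upperOnlyC` — **the C′ crux with its LOWER bound deleted HOLDS** for every compact
  second-countable `G` and continuous unitary `ρ`: a CONTINUOUS unit map `a > 0`, `a → 0` and `β₀`
  with `n⁸ Cov(P_0^{01}, P_{ne₂}^{01}) ≤ 1` (`1 ≤ n`, `8n ≤ L`) and `|Cov(P_x^{ij}, P_y^{i'j'})| dist⁸ ≤ 1`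
  on every torus with `β ≥ β₀`, `L · a(β) ≤ 1` (`Γ ≡ 1`, `C = 1`, `ℓ₀ = 1`). So the token
  `Continuous a` adds nothing on the upper side: as for the typed item (`Negative.UpperOnly`), the
  lower bound is the unique load-bearing clause — now read ALONG RG CHAINS
  (`Negative.UniformFreezing`).
* `exists_parasitic` (abstract) / `forallA_lowerBound_false` — **the `∀ a`-strengthening is FALSE**:
  for every compact second-countable `G` and continuous unitary `ρ` there is a continuous unit map
  `a > 0`, `a → 0` (decaying slowly through the diagonal freezing thresholds) along which NO
  `(Γ, β₀, ℓ₀, c)` satisfies even the lower-bound clause alone. Continuity does not pin the unit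
  map; two-sidedness along the chains does.
-/

noncomputable section

open Filter Topology MeasureTheory Set
open Literature.MathematicalPhysics.QuantumFieldTheory Literature.MathematicalPhysics.QuantumLattice
open Summit.QuantumFields.YangMills.Theorems.TunedSequenceExists.Negative.Freezing
  (secondCountable_of_latticeRep)
open Summit.QuantumFields.YangMills.Theorems.FemtoCurvatureTwoPoint.Negative

namespace Summit.QuantumFields.YangMills.Theorems.FemtoCurvatureTwoPointC.Negative.UpperOnlyC

/-! ## Analysis: a continuous majorant tending to zero -/

/-- **Continuous majorant tending to zero.** Every `σ : ℝ → ℝ` with `0 < σ ≤ 1` and `σ → 0` at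
`+∞` lies below a CONTINUOUS positive `g` with `g → 0`: `g(β) = ∫_β^{β+1} E` for the running
supremum `E(t) = sup_{u ≥ t-1} σ(u)` (antitone, hence locally integrable;
`E(β+1) ≤ g(β) ≤ E(β)`). -/
theorem exists_continuous_majorant {σ : ℝ → ℝ} (hσ0 : ∀ β, 0 < σ β) (hσ1 : ∀ β, σ β ≤ 1)
    (hσ : Tendsto σ atTop (𝓝 0)) :
    ∃ g : ℝ → ℝ, Continuous g ∧ (∀ β, σ β ≤ g β) ∧ (∀ β, 0 < g β) ∧ Tendsto g atTop (𝓝 0) := by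
  -- running supremum
  set E : ℝ → ℝ := fun t => sSup (σ '' Ici (t - 1)) with hE_def
  have hbdd : ∀ t, BddAbove (σ '' Ici (t - 1)) := fun t =>
    ⟨1, by rintro _ ⟨u, -, rfl⟩; exact hσ1 u⟩
  have hne : ∀ t, (σ '' Ici (t - 1)).Nonempty := fun t => ⟨σ t, t, by simp, rfl⟩
  have hEσ : ∀ {t u : ℝ}, t - 1 ≤ u → σ u ≤ E t := fun {t u} h => le_csSup (hbdd t) ⟨u, h, rfl⟩
  have hE0 : ∀ t, 0 < E t := fun t => (hσ0 t).trans_le (hEσ (by linarith))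
  have hEanti : Antitone E := fun t t' htt' =>
    csSup_le_csSup (hbdd t) (hne t') (image_mono (Ici_subset_Ici.2 (by linarith)))
  have hEint : ∀ x y : ℝ, IntervalIntegrable E volume x y := fun x y =>
    (hEanti.antitoneOn _).intervalIntegrable
  have hEt : Tendsto E atTop (𝓝 0) := by
    refine Metric.tendsto_atTop.2 fun ε hε => ?_
    obtain ⟨B, hB⟩ := eventually_atTop.1 (hσ.eventually (Iio_mem_nhds (half_pos hε)))
    refine ⟨B + 1, fun t ht => ?_⟩
    rw [Real.dist_eq, sub_zero, abs_of_pos (hE0 t)]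
    refine lt_of_le_of_lt (csSup_le (hne t) ?_) (half_lt_self hε)
    rintro _ ⟨u, hu, rfl⟩
    exact le_of_lt (hB u (by simp only [mem_Ici] at hu; linarith))
  -- the majorant `g β = F (β + 1) - F β`, `F` the primitive of `E`
  set F : ℝ → ℝ := fun x => ∫ t in (0 : ℝ)..x, E t with hF_def
  have hF : Continuous F := intervalIntegral.continuous_primitive hEint 0
  have hg_eq : ∀ β : ℝ, F (β + 1) - F β = ∫ t in β..β + 1, E t := fun β =>
    intervalIntegral.integral_interval_sub_left (hEint 0 (β + 1)) (hEint 0 β)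
  have hg_lower : ∀ β : ℝ, E (β + 1) ≤ F (β + 1) - F β := fun β => by
    rw [hg_eq]
    have h : (∫ _ in β..β + 1, E (β + 1)) ≤ ∫ u in β..β + 1, E u :=
      intervalIntegral.integral_mono_on (by linarith) intervalIntegrable_const (hEint β (β + 1))
        (fun t ht => hEanti ht.2)
    rwa [intervalIntegral.integral_const, show β + 1 - β = (1 : ℝ) by ring, one_smul] at h
  have hg_upper : ∀ β : ℝ, F (β + 1) - F β ≤ E β := fun β => by
    rw [hg_eq]
    have h : (∫ u in β..β + 1, E u) ≤ ∫ _ in β..β + 1, E β :=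
      intervalIntegral.integral_mono_on (by linarith) (hEint β (β + 1)) intervalIntegrable_const
        (fun t ht => hEanti ht.1)
    rwa [intervalIntegral.integral_const, show β + 1 - β = (1 : ℝ) by ring, one_smul] at h
  refine ⟨fun β => F (β + 1) - F β, (hF.comp (continuous_id.add continuous_const)).sub hF,
    fun β => (hEσ (by linarith)).trans (hg_lower β), fun β => (hE0 _).trans_le (hg_lower β), ?_⟩
  exact tendsto_of_tendsto_of_tendsto_of_le_of_le tendsto_const_nhds hEt
    (fun β => ((hE0 _).trans_le (hg_lower β)).le) hg_upper

/-! ## Abstract: a parasitic continuous unit map for any freezing array of amplitudes -/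

/-- **Parasitic continuous unit maps exist.** Let `A m β` be any array with `A m β → 0` as `β → ∞`
for each fixed `m` ("freezing of the amplitude at separation `m+1` on the fixed torus `8(m+1)`").
Then there is a CONTINUOUS positive unit map `a → 0` such that NO shape `Γ > 0` on `(0, ℓ₀]`,
`ℓ₀, c > 0`, `β₀` satisfy the crux's lower-bound shape `c · Γ((m+1) a(β)) ≤ A m β` on the femto
diagonal (`β ≥ β₀`, `8(m+1) a(β) ≤ ℓ₀`). Construction: `a` is a continuous majorant of the step
`1/(M(β)+1)`, `M(β)` counting the freezing thresholds `T'(m)` passed (`A m β ≤ 1/(m+1)` beyond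
`T(m) ≤ T'(m)`); any level `s ≤ 1/2` of the chain `(m+1) a(β) = s` is then reached only beyond
`T(m)`, forcing `c Γ(s) ≤ 1/(m+1)` for every `m`. -/
theorem exists_parasitic {A : ℕ → ℝ → ℝ} (hA : ∀ m : ℕ, Tendsto (A m) atTop (𝓝 0)) :
    ∃ a : ℝ → ℝ, Continuous a ∧ (∀ β, 0 < a β) ∧ Tendsto a atTop (𝓝 0) ∧
      ∀ (Γ : ℝ → ℝ) (β₀ ℓ₀ c : ℝ), 0 < ℓ₀ → 0 < c → (∀ s : ℝ, 0 < s → s ≤ ℓ₀ → 0 < Γ s) →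
        ¬ ∀ (m : ℕ) (β : ℝ), β₀ ≤ β → 8 * (((m + 1 : ℕ) : ℝ) * a β) ≤ ℓ₀ →
            c * Γ (((m + 1 : ℕ) : ℝ) * a β) ≤ A m β := by
  classical
  -- freezing thresholds: beyond `T m`, `A m β ≤ 1/(m+1)`
  have hE : ∀ m : ℕ, ∀ᶠ β in atTop, A m β ≤ 1 / ((m : ℝ) + 1) := fun m =>
    (hA m).eventually (Iic_mem_nhds (by positivity : (0 : ℝ) < 1 / ((m : ℝ) + 1)))
  choose T hT using fun m => eventually_atTop.1 (hE m)
  -- monotone envelope `T' m ≥ max (T m) m`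
  set T' : ℕ → ℝ := fun m => (∑ k ∈ Finset.range (m + 1), |T k|) + m with hT'_def
  have hT'T : ∀ m, T m ≤ T' m := fun m => by
    have h1 : |T m| ≤ ∑ k ∈ Finset.range (m + 1), |T k| :=
      Finset.single_le_sum (fun k _ => abs_nonneg (T k)) (Finset.self_mem_range_succ m)
    have h2 := le_abs_self (T m)
    have h3 : (0 : ℝ) ≤ m := Nat.cast_nonneg m
    simp only [hT'_def]
    linarith
  have hT'm : ∀ m : ℕ, (m : ℝ) ≤ T' m := fun m => by
    have := Finset.sum_nonneg fun k (_ : k ∈ Finset.range (m + 1)) => abs_nonneg (T k)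
    simp only [hT'_def]
    linarith
  have hT'mono : ∀ {m m' : ℕ}, m ≤ m' → T' m ≤ T' m' := fun {m m'} hmm' => by
    simp only [hT'_def]
    have h1 : ∑ k ∈ Finset.range (m + 1), |T k| ≤ ∑ k ∈ Finset.range (m' + 1), |T k| :=
      Finset.sum_le_sum_of_subset_of_nonneg (Finset.range_mono (by omega))
        fun k _ _ => abs_nonneg (T k)
    have h2 : (m : ℝ) ≤ m' := by exact_mod_cast hmm'
    linarith
  -- counting function and the step minorant `σ = 1/(M+1)`
  set M : ℝ → ℕ := fun β => Nat.findGreatest (fun m => T' m ≤ β) ⌊β⌋₊ with hM_def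
  have hMge : ∀ (β : ℝ) (m : ℕ), T' m ≤ β → m ≤ M β := fun β m hm =>
    Nat.le_findGreatest (Nat.le_floor ((hT'm m).trans hm)) hm
  have hMspec : ∀ β : ℝ, M β ≠ 0 → T' (M β) ≤ β := fun β h =>
    Nat.findGreatest_of_ne_zero rfl h
  set σ : ℝ → ℝ := fun β => 1 / ((M β : ℝ) + 1) with hσ_def
  have hσ0 : ∀ β, 0 < σ β := fun β => by simp only [hσ_def]; positivity
  have hσ1 : ∀ β, σ β ≤ 1 := fun β => by
    simp only [hσ_def]
    rw [div_le_one (by positivity)]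
    linarith [Nat.cast_nonneg (α := ℝ) (M β)]
  have hσt : Tendsto σ atTop (𝓝 0) := by
    refine Metric.tendsto_atTop.2 fun ε hε => ?_
    obtain ⟨k, hk⟩ := exists_nat_one_div_lt hε
    refine ⟨T' k, fun β hβ => ?_⟩
    rw [Real.dist_eq, sub_zero, abs_of_pos (hσ0 β)]
    have hkM : (k : ℝ) + 1 ≤ (M β : ℝ) + 1 := by exact_mod_cast Nat.succ_le_succ (hMge β k hβ)
    calc σ β = 1 / ((M β : ℝ) + 1) := rfl
      _ ≤ 1 / ((k : ℝ) + 1) := one_div_le_one_div_of_le (by positivity) hkM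
      _ < ε := hk
  -- KEY: the level `1/(m+2)` of `σ` is reached only beyond the threshold `T m`
  have hP : ∀ (m : ℕ) (β : ℝ), σ β ≤ 1 / ((m : ℝ) + 2) → T m ≤ β := fun m β hle => by
    have h1 : (m : ℝ) + 2 ≤ (M β : ℝ) + 1 :=
      (one_div_le_one_div (by positivity) (by positivity)).1 hle
    have h2 : m + 1 ≤ M β := by exact_mod_cast (by linarith : (m : ℝ) + 1 ≤ M β)
    exact (hT'T m).trans ((hT'mono (by omega : m ≤ M β)).trans (hMspec β (by omega)))
  -- the parasitic CONTINUOUS unit map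
  obtain ⟨g, hg, hσg, hg0, hgt⟩ := exists_continuous_majorant hσ0 hσ1 hσt
  refine ⟨g, hg, hg0, hgt, fun Γ β₀ ℓ₀ c hℓ hc hΓ hlow => ?_⟩
  -- a chain level `s ≤ min (g β₀) (ℓ₀/8) (1/2)`
  set s : ℝ := min (g β₀) (min (ℓ₀ / 8) (1 / 2)) with hs_def
  have hs0 : 0 < s := lt_min (hg0 β₀) (lt_min (by linarith) (by norm_num))
  have hsg : s ≤ g β₀ := min_le_left _ _
  have hsℓ : 8 * s ≤ ℓ₀ := by
    have := (min_le_right (g β₀) _).trans (min_le_left (ℓ₀ / 8) (1 / 2)); linarith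
  have hs2 : s ≤ 1 / 2 := (min_le_right (g β₀) _).trans (min_le_right _ _)
  have hΓs : 0 < Γ s := hΓ s hs0 (by linarith)
  -- along the chain the lower bound sits below `1/(m+1)` for EVERY `m`
  have hchain : ∀ m : ℕ, c * Γ s ≤ 1 / ((m : ℝ) + 1) := fun m => by
    have hmpos : (0 : ℝ) < ((m + 1 : ℕ) : ℝ) := by positivity
    -- the level `s/(m+1)` is attained at some `β ≥ β₀` (intermediate values)
    have hlev : s / ((m + 1 : ℕ) : ℝ) ≤ g β₀ :=
      (div_le_self hs0.le (by exact_mod_cast Nat.succ_le_succ (Nat.zero_le m))).trans hsg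
    obtain ⟨B', hB's, hBB'⟩ :=
      ((hgt.eventually (Iio_mem_nhds (div_pos hs0 hmpos))).and (eventually_ge_atTop β₀)).exists
    obtain ⟨β, hβmem, hβs⟩ :=
      intermediate_value_Icc' hBB' hg.continuousOn ⟨le_of_lt hB's, hlev⟩
    have hβ0 : β₀ ≤ β := hβmem.1
    have harg : ((m + 1 : ℕ) : ℝ) * g β = s := by rw [hβs]; field_simp
    -- lower bound at `(m, β)`
    have hlb : c * Γ s ≤ A m β := by
      have := hlow m β hβ0 (by rw [harg]; exact hsℓ)
      rwa [harg] at this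
    -- `σ β ≤ g β = s/(m+1) ≤ 1/(m+2)`, so `β ≥ T m` and `A m β ≤ 1/(m+1)`
    have hkey : ((m : ℝ) + 2) * s ≤ (m : ℝ) + 1 := by
      have := mul_le_mul_of_nonneg_left hs2 (by positivity : (0 : ℝ) ≤ (m : ℝ) + 2)
      have hm0 : (0 : ℝ) ≤ m := Nat.cast_nonneg m
      linarith
    have hσle : σ β ≤ 1 / ((m : ℝ) + 2) := by
      refine (hσg β).trans ?_
      have hmpos' : (0 : ℝ) < (m : ℝ) + 1 := by positivity
      have hgβ : g β = s / ((m : ℝ) + 1) := by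
        rw [eq_div_iff hmpos'.ne']
        push_cast at harg
        linear_combination harg
      rw [hgβ, div_le_iff₀ hmpos', one_div, le_inv_mul_iff₀ (by positivity : (0 : ℝ) < (m : ℝ) + 2)]
      exact hkey
    exact hlb.trans (hT m β (hP m β hσle))
  obtain ⟨m, hm⟩ := exists_nat_one_div_lt (mul_pos hc hΓs)
  exact absurd (hchain m) (not_le.2 hm)

/-! ## The crux's own amplitudes -/

variable {G : Type} [Group G] [TopologicalSpace G] [IsTopologicalGroup G] [CompactSpace G]

section Rho

variable [MeasurableSpace G] [BorelSpace G] {N : ℕ} (ρ : G →* Matrix (Fin N) (Fin N) ℂ)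

/-- **The upper-only variant of C′ HOLDS** (every compact second-countable `G`, continuous unitary
`ρ`): there are a CONTINUOUS unit map `a > 0` with `a → 0` and `β₀` such that on every torus with
`β ≥ β₀` and `L · a(β) ≤ 1`, `n⁸ Cov(P_0^{01}, P_{ne₂}^{01}) ≤ 1` for `1 ≤ n`, `8n ≤ L`, and
`|Cov(P_x^{ij}, P_y^{i'j'})| · dist(x,y)⁸ ≤ 1` for all plaquette pairs — the conclusion of
`FemtoCurvatureTwoPointC` with `Γ ≡ 1`, `C = 1`, `ℓ₀ = 1` and the lower bound removed. Proof: a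
continuous majorant of the typed item's slow step unit map (`Negative.UpperOnly.exists_upperOnly`),
whose femto family is smaller. -/
theorem exists_upperOnlyC [SecondCountableTopology G] (hρ : Continuous ρ)
    (hρu : ∀ g, ρ g ∈ Matrix.unitaryGroup (Fin N) ℂ) :
    ∃ (a : ℝ → ℝ) (β₀ : ℝ), Continuous a ∧ (∀ β, 0 < a β) ∧ Tendsto a atTop (𝓝 0) ∧
      ∀ (L : ℕ) [NeZero L] (β : ℝ), β₀ ≤ β → (L : ℝ) * a β ≤ 1 →
        (∀ n : ℕ, 1 ≤ n → 8 * n ≤ L →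
          (n : ℝ) ^ 8 *
            (wilsonExpectation (d := 4) (L := L) ρ β (fun U =>
                ((N : ℝ) - (ρ (plaquetteHolonomy U (0 : Site 4 L) 0 1)).trace.re) *
                  ((N : ℝ) - (ρ (plaquetteHolonomy U (Pi.single (2 : Fin 4) ((n : ℕ) : ZMod L))
                    0 1)).trace.re)) -
              wilsonExpectation (d := 4) (L := L) ρ β
                  (fun U => (N : ℝ) - (ρ (plaquetteHolonomy U (0 : Site 4 L) 0 1)).trace.re) *
                wilsonExpectation (d := 4) (L := L) ρ β (fun U => (N : ℝ) -
                  (ρ (plaquetteHolonomy U (Pi.single (2 : Fin 4) ((n : ℕ) : ZMod L)) 0 1)).trace.re))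
            ≤ 1) ∧
        ∀ (x y : Site 4 L) (i j i' j' : Fin 4),
          |wilsonExpectation (d := 4) (L := L) ρ β (fun U =>
                ((N : ℝ) - (ρ (plaquetteHolonomy U x i j)).trace.re) *
                  ((N : ℝ) - (ρ (plaquetteHolonomy U y i' j')).trace.re)) -
              wilsonExpectation (d := 4) (L := L) ρ β
                  (fun U => (N : ℝ) - (ρ (plaquetteHolonomy U x i j)).trace.re) *
                wilsonExpectation (d := 4) (L := L) ρ β
                  (fun U => (N : ℝ) - (ρ (plaquetteHolonomy U y i' j')).trace.re)| *
              Real.sqrt (∑ k : Fin 4, (((x k - y k).valMinAbs : ℤ) : ℝ) ^ 2) ^ 8 ≤ 1 := by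
  obtain ⟨a, β₀, ha, hat, hcl⟩ := UpperOnly.exists_upperOnly ρ hρ hρu
  -- truncate at `1` and majorise continuously
  have hσ0 : ∀ β, 0 < min (a β) 1 := fun β => lt_min (ha β) one_pos
  have hσ1 : ∀ β, min (a β) 1 ≤ 1 := fun β => min_le_right _ _
  have hσt : Tendsto (fun β => min (a β) 1) atTop (𝓝 0) := by
    simpa using hat.min (tendsto_const_nhds (x := (1 : ℝ)))
  obtain ⟨g, hg, hσg, hg0, hgt⟩ := exists_continuous_majorant hσ0 hσ1 hσt
  obtain ⟨B, hB⟩ := eventually_atTop.1 (hat.eventually (Iic_mem_nhds one_pos))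
  refine ⟨g, max β₀ B, hg, hg0, hgt, fun L _ β hβ hL => ?_⟩
  have haβ : a β ≤ 1 := hB β ((le_max_right _ _).trans hβ)
  have hag : a β ≤ g β := by have := hσg β; rwa [min_eq_left haβ] at this
  have hL' : (L : ℝ) * a β ≤ 1 := (mul_le_mul_of_nonneg_left hag (Nat.cast_nonneg L)).trans hL
  exact hcl L β ((le_max_left _ _).trans hβ) hL'

/-- **The `∀ a`-strengthening of C′ is FALSE** (every compact second-countable `G`, continuous
unitary `ρ`): it is NOT true that every continuous unit map `a > 0`, `a → 0` carries data
`(Γ, β₀, ℓ₀, c)` with `ℓ₀, c > 0`, `Γ > 0` on `(0, ℓ₀]` and the crux's LOWER-bound clause on femto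
tori (a fortiori no full package). Witness: the parasitic map of `exists_parasitic` for the crux's
diagonal amplitudes, which freeze on every fixed torus (`Negative.PlaquetteFreezing`). -/
theorem forallA_lowerBound_false [SecondCountableTopology G] (hρ : Continuous ρ)
    (hρu : ∀ g, ρ g ∈ Matrix.unitaryGroup (Fin N) ℂ) :
    ¬ ∀ a : ℝ → ℝ, Continuous a → (∀ β, 0 < a β) → Tendsto a atTop (𝓝 0) →
        ∃ (Γ : ℝ → ℝ) (β₀ ℓ₀ c : ℝ), 0 < ℓ₀ ∧ 0 < c ∧ (∀ s : ℝ, 0 < s → s ≤ ℓ₀ → 0 < Γ s) ∧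
          ∀ (L : ℕ) [NeZero L] (β : ℝ), β₀ ≤ β → (L : ℝ) * a β ≤ ℓ₀ →
            ∀ n : ℕ, 1 ≤ n → 8 * n ≤ L →
              c * Γ ((n : ℝ) * a β) ≤ (n : ℝ) ^ 8 *
                (wilsonExpectation (d := 4) (L := L) ρ β (fun U =>
                    ((N : ℝ) - (ρ (plaquetteHolonomy U (0 : Site 4 L) 0 1)).trace.re) *
                      ((N : ℝ) - (ρ (plaquetteHolonomy U (Pi.single (2 : Fin 4) ((n : ℕ) : ZMod L))
                        0 1)).trace.re)) -
                  wilsonExpectation (d := 4) (L := L) ρ β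
                      (fun U => (N : ℝ) - (ρ (plaquetteHolonomy U (0 : Site 4 L) 0 1)).trace.re) *
                    wilsonExpectation (d := 4) (L := L) ρ β (fun U => (N : ℝ) -
                      (ρ (plaquetteHolonomy U (Pi.single (2 : Fin 4) ((n : ℕ) : ZMod L))
                        0 1)).trace.re)) := by
  intro hall
  -- the diagonal amplitudes freeze on every fixed torus
  have hA : ∀ m : ℕ, Tendsto (fun β : ℝ => ((m + 1 : ℕ) : ℝ) ^ 8 *
      (wilsonExpectation (d := 4) (L := 8 * (m + 1)) ρ β (fun U =>
          ((N : ℝ) - (ρ (plaquetteHolonomy U (0 : Site 4 (8 * (m + 1))) 0 1)).trace.re) *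
            ((N : ℝ) - (ρ (plaquetteHolonomy U (Pi.single (2 : Fin 4)
              (((m + 1 : ℕ) : ℕ) : ZMod (8 * (m + 1)))) 0 1)).trace.re)) -
        wilsonExpectation (d := 4) (L := 8 * (m + 1)) ρ β
            (fun U => (N : ℝ) - (ρ (plaquetteHolonomy U (0 : Site 4 (8 * (m + 1))) 0 1)).trace.re) *
          wilsonExpectation (d := 4) (L := 8 * (m + 1)) ρ β (fun U => (N : ℝ) -
            (ρ (plaquetteHolonomy U (Pi.single (2 : Fin 4)
              (((m + 1 : ℕ) : ℕ) : ZMod (8 * (m + 1)))) 0 1)).trace.re))) atTop (𝓝 0) := fun m => by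
    have ht := (PlaquetteFreezing.tendsto_plaquetteCov ρ hρ hρu (0 : Site 4 (8 * (m + 1)))
      (Pi.single (2 : Fin 4) (((m + 1 : ℕ) : ℕ) : ZMod (8 * (m + 1)))) 0 1 0 1).const_mul
      (((m + 1 : ℕ) : ℝ) ^ 8)
    rwa [mul_zero] at ht
  obtain ⟨a, hcont, ha, hat, hnone⟩ := exists_parasitic hA
  obtain ⟨Γ, β₀, ℓ₀, c, hℓ, hc, hΓ, hlow⟩ := hall a hcont ha hat
  refine hnone Γ β₀ ℓ₀ c hℓ hc hΓ fun m β hβ hfem => ?_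
  have hfem' : ((8 * (m + 1) : ℕ) : ℝ) * a β ≤ ℓ₀ := by push_cast at hfem ⊢; linarith
  exact hlow (8 * (m + 1)) β hβ hfem' (m + 1) (Nat.succ_le_succ (Nat.zero_le m)) le_rfl

end Rho

/-- The faithful-representation form (the crux's Borel σ-algebra; second countability from `r`). -/
theorem exists_upperOnlyC_rep (r : LatticeRep G) :
    letI : MeasurableSpace G := borel G
    haveI : BorelSpace G := ⟨rfl⟩
    ∃ (a : ℝ → ℝ) (β₀ : ℝ), Continuous a ∧ (∀ β, 0 < a β) ∧ Tendsto a atTop (𝓝 0) ∧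
      ∀ (L : ℕ) [NeZero L] (β : ℝ), β₀ ≤ β → (L : ℝ) * a β ≤ 1 →
        (∀ n : ℕ, 1 ≤ n → 8 * n ≤ L →
          (n : ℝ) ^ 8 *
            (wilsonExpectation (d := 4) (L := L) r.ρ β (fun U =>
                ((r.N : ℝ) - (r.ρ (plaquetteHolonomy U (0 : Site 4 L) 0 1)).trace.re) *
                  ((r.N : ℝ) - (r.ρ (plaquetteHolonomy U (Pi.single (2 : Fin 4)
                    ((n : ℕ) : ZMod L)) 0 1)).trace.re)) -
              wilsonExpectation (d := 4) (L := L) r.ρ β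
                  (fun U => (r.N : ℝ) - (r.ρ (plaquetteHolonomy U (0 : Site 4 L) 0 1)).trace.re) *
                wilsonExpectation (d := 4) (L := L) r.ρ β (fun U => (r.N : ℝ) -
                  (r.ρ (plaquetteHolonomy U (Pi.single (2 : Fin 4) ((n : ℕ) : ZMod L))
                    0 1)).trace.re))
            ≤ 1) ∧
        ∀ (x y : Site 4 L) (i j i' j' : Fin 4),
          |wilsonExpectation (d := 4) (L := L) r.ρ β (fun U =>
                ((r.N : ℝ) - (r.ρ (plaquetteHolonomy U x i j)).trace.re) *
                  ((r.N : ℝ) - (r.ρ (plaquetteHolonomy U y i' j')).trace.re)) -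
              wilsonExpectation (d := 4) (L := L) r.ρ β
                  (fun U => (r.N : ℝ) - (r.ρ (plaquetteHolonomy U x i j)).trace.re) *
                wilsonExpectation (d := 4) (L := L) r.ρ β
                  (fun U => (r.N : ℝ) - (r.ρ (plaquetteHolonomy U y i' j')).trace.re)| *
              Real.sqrt (∑ k : Fin 4, (((x k - y k).valMinAbs : ℤ) : ℝ) ^ 2) ^ 8 ≤ 1 := by
  letI : MeasurableSpace G := borel G
  haveI : BorelSpace G := ⟨rfl⟩
  haveI : SecondCountableTopology G := secondCountable_of_latticeRep r
  exact exists_upperOnlyC r.ρ r.continuous r.mem_unitary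

end Summit.QuantumFields.YangMills.Theorems.FemtoCurvatureTwoPointC.Negative.UpperOnlyC

end
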